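import Summits.QuantumFields.BalabanUV.T4Continuum.Support.NE7ApeFlatSkeleton
import Summits.QuantumFields.BalabanUV.T4Continuum.Support.NE3SmoothRightInverseCurl
import Summits.QuantumFields.BalabanUV.T4Continuum.Support.NE3FlatHessianCurl
import Summits.QuantumFields.BalabanUV.T4Continuum.Support.NE3TangentFlatPush
import Literature.MathematicalPhysics.QuantumFieldTheory.Balaban1983to89.B5Hk163RDiv
import Literature.MathematicalPhysics.QuantumFieldTheory.Balaban1983to89.B5Hk160Torus
import Literature.MathematicalPhysics.QuantumFieldTheory.Balaban1983to89.B5Blocks16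
import Literature.MathematicalPhysics.QuantumFieldTheory.Balaban1983to89.Beta.Ineq167Operator
import Summits.QuantumFields.BalabanUV.T4Continuum.Support.NE7FlatAverageBridge
import Summits.QuantumFields.BalabanUV.T4Continuum.Support.NE3SmoothRightInverseFlat
import Summits.QuantumFields.BalabanUV.T4Continuum.Support.NE7TorusBoxDictionary
import Summits.QuantumFields.BalabanUV.T4Continuum.Support.NE7FlatHkRightInverse
import HarnessLib

/-!
# NE7FlatHkOrthogonal — BRICK 3c OF THE BRIDGE: THE (R⊥♭) LETTER IN KERNEL — lit-balaban's Landau lift `H_k`, pulled back entrywise and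
# corrected (F36), is `hess`-ORTHOGONAL at the flat background to EVERY skew periodic T4 tangent direction (`cpushIter L j flat Y = 0`)

Cell `pub-balaban`, rung (B)+1 sub-cell t4, lineage `b2b-balaban-t4-ne7-p1`, generation 70 (CRUX PROVER NE7 #1); memo
`t4/b2b-balaban-t4-ne7-p1-g70/HUNT-H14-APE-FLAT-SKELETON.md` §2.  File F40 (over F38 `NE7ApeFlatSkeleton.hess_flat`, F35 `NE7FlatAverageBridge.linQ_pullback_eq`,
row NE3's `NE3TangentFlatStructure` (`iterate_Tcoarse_eq_zero_iff`, `framePot_add_period`), `NE3SmoothRightInverseFlat` (`cpushIter_flat`,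
`iterate_Qcoarse_apply`), `NE3SmoothRightInverseCurl` (`curlAt_flat_add ∕ _dPot`), and lit-balaban's `B5Hk163RDiv.curl_HkOp_orthogonal`
([Balaban1984PropagatorsI] p. 29, third property of `H_k`), `B5Hk160Torus.QvOp_GradOp_mulVec` ((1.20)), `B5Blocks16.QsOp_blockConst`,
`Beta.Ineq167Operator.Fs_add ∕ Fs_grad` ((1.4))).
WHY.  F38's pointwise bootstrap needs the normal part `A_N = R(D_{F̃}A)` to be `hess`-ORTHOGONAL to the tangent space `T(F̃)` ((R⊥): the cross term
`hess F̃ A_N Y` vanishes identically, so no `ℓ^∞` Riesz-transform bound is needed — Bałaban's choice of `H₀` as the `Δ_a`-minimiser,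
[Balaban1985Variational] p. 298).  At the TRIVIAL flat datum the lift is bricks 2–3's `R_H B = A_H + dPot (interp n univ (framePot L (j+1) A_H))`;
THIS FILE proves (R⊥) for it.  The one subtlety: T4's tangent space at the flat background is NOT the kernel of the straight average — a tangent `Y`
has straight `(j+1)`-fold average equal to the COBOUNDARY of row NE3's frame potential (`iterate_Tcoarse_eq_zero_iff`); on the torus side this
says `Q_k y = ∂₁g` entry by entry, and subtracting the block-constant pure gauge `∂(g ∘ blockOf)` ((1.20) `Q_k∂ = ∂₁Q′_k`, `Q′_k(g ∘ blockOf) = g`)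
lands in `N(Q_k)` without changing the plaquette field ((1.4)), where lit-balaban's orthogonality applies.
WHAT ([folklore] dictionary bookkeeping over lit-balaban's kernel theorem; 0 def, 0 sorry).
§1 `periodBox_eq_pbox`, `sum_periodBox_toT` (box ↔ cubic torus sums, complex-valued), `sum_sum_eq_two_mul_sum_plane_complex` (ordered pairs ↔ planes).
§2 `toT_add_e'`, `apply_add_of_isPeriod'`, `apply_rep_toT'` (general dimension), `Fs_eq_mul_Fs_one`, **`curlAt_flat_entry_torus`** (the flat curl of a
   periodic field, entrywise, is lit-balaban's `Fs` of its torus restriction).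
§3 **`sum_conj_Fs_mul_Fs_HkOp_eq_zero`** — torus side: `Q_k a = ∂₁g` ⟹ `Σ_t Σ_{μ,ν} conj(F¹_{μν}(a))·F¹_{μν}(H_kB) = 0`.
§4 `applyS_rep_toT`, **`qvOp_entry_coarse_exact`** — T4 side: `cpushIter L j flat Y = 0` ⟹ every entry of `Y`'s torus restriction has
   `Q_k y_{ii′} = ∂₁(n⁻¹·(framePot L (j+1) Y ∘ rep)_{ii′})`.
§5 `entry_eq_neg_conj_of_skew`, **`hess_flat_hkLift_eq_zero`** — THE (R⊥♭) LETTER: `hess flat (R_H B) Y (perWin d (n·P)) = 0` for every skew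
   `(n·P)`-periodic `Y` with `cpushIter L j flat Y = 0`, every `B`, every `L ≥ 1`, `j`, `P ≥ 1`, general `d`.
AFTER THIS FILE the LIFT♭ letters of F38's bundle at the trivial flat datum read: exactness ✓ (F36 `cpushIter_flat_hkPull`), (R7♭) (F37, submitted),
(R⊥♭) ✓ (this file); OPEN: the commuting-holonomy twist (brick 4), skewness∕periodicity bookkeeping of `R_H` on skew periodic data (routine), and the
other letters (REP♭, G♭, EXP, TT).
HONEST FRAMING (page 1): index bookkeeping between two typed dictionaries + lit-balaban's kernel theorem (abelian, flat, `U = 1`); nothing of Bałaban's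
asserted; NOT (APE), NOT ONE-STEP, NOT NE7; spine 0∕9; finite T⁴ rung (B)+1 — NOT infinite volume, NOT mass gap, NOT Clay.  Continuum YM on T⁴ ⇐
BetaPertH ∧ nine spine estimates (0/9 proved); BetaPertH ⇐ (D1) ∧ (D4) ∧ CAP+tail; G-an2-4 gates asym, D1 and NE2/3/4.
-/

set_option autoImplicit false

open scoped BigOperators Matrix ComplexConjugate Matrix.Norms.L2Operator
open Finset

namespace Summit.QuantumFields.BalabanUV.T4Continuum.NE7FlatHkOrthogonal

open Literature.MathematicalPhysics.QuantumFieldTheory.Balaban1983to89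
open B7Prop1Explicit (Site e e_apply)
open T4AveragingDeficitWall (curlAt curl IsSkewDir SmallField)
open T4AveragingDeficitWallBoundary (periodBox mem_periodBox)
open AveragingDeficitPeriodicCounting (IsPeriodicDir)
open B5Prop11Plancherel (Tor fine)
open B5Action121 (Fs Fs_apply GradOp GradOp_mulVec sdiff_mulVec CurlOp CurlOp_mulVec)
open B5Block118 (QvOp)
open B5Blocks16 (blockOf QsOp_blockConst)
open B5Hk160Torus (QvOp_GradOp_mulVec)
open B5Hk163Torus (HkOp)
open B5Hk163RDiv (curl_HkOp_orthogonal)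
open B6Lemma24Torus (pbox mem_pbox IsPeriod)
open B6LowerBound2153Torus (toT rep toT_add toT_rep rep_toT rep_mem_pbox isPeriod_rep_toT_sub)
open BlockAveragePushDirSplit (flat)
open SmoothRefineInterp (interp)
open NE3TangentNoGoWords (dPot)
open NE3TangentFlatStructure (framePot Qcoarse iterate_Tcoarse_eq_zero_iff framePot_add_period)
open NE3SmoothRightInverseFlat (cpushIter_flat iterate_Qcoarse_apply)
open NE7FlatAverageBridge (linQ_pullback_eq)
open NE7FlatHkRightInverse (linQ_apply_entry)
open B7Prop3Flat (linQ)
open B7Prop4Flat (linQ_eq_sum)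
open ReplicationRightInverse (cpushIter)
open NE3SmoothLiftCurl (curlAt_flat_eq)
open NE3SmoothRightInverseCurl (curlAt_flat_dPot curlAt_flat_add)
open NE3HessForm (hess)
open MinimalActionLevels (perWin)
open NE3FlatHessianCurl (smallField_flatCfg_zero)
open NE3TangentFlatPush (flatCfg_eq_flat)
open NE7ApeFlatSkeleton (hess_flat)

open NE7TorusBoxDictionary (sum_periodBox_toT sum_sum_eq_two_mul_sum_plane_complex toT_add_e' apply_rep_toT' curlAt_flat_entry_torus)

noncomputable section

variable {d : ℕ} {n : Type*} [Fintype n] [DecidableEq n]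

omit [Fintype n] [DecidableEq n] in
/-- `Fs N c A = c·Fs N 1 A`. [folklore] -/
theorem Fs_eq_mul_Fs_one (N : Fin d → ℕ) [∀ μ, NeZero (N μ)] (c : ℂ) (A : Tor N × Fin d → ℂ) (μ ν : Fin d) (x : Tor N) :
    Fs N c A μ ν x = c * Fs N 1 A μ ν x := by
  rw [Fs_apply, Fs_apply, one_mul]

/-! ## §3 The torus-side orthogonality with a coarse-exact average (lit-balaban's minimum property + (1.20)) -/

omit [Fintype n] [DecidableEq n] in
/-- **«⟨∂A′, ∂H_kB⟩ = 0» FOR `A′` WITH A COARSE-EXACT AVERAGE**: if `Q_k a (t,κ) = g(t + u_κ) − g(t)` for a coarse scalar `g`, then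
`Σ_t Σ_{μ,ν} conj(F¹_{μν}(a)(t))·F¹_{μν}(H_kB)(t) = 0` — subtract the pure gauge `∂(g ∘ blockOf)` ((1.20): `Q_k∂ = ∂₁Q′_k`, `Q′_k` of a
block-constant function is that function), which has the same plaquette field ((1.4)) and a vanishing average, and apply lit-balaban's
`B5Hk163RDiv.curl_HkOp_orthogonal`. [cite: Balaban1984PropagatorsI, p.29 (text); (1.20) p.20; (1.4) p.18] -/
theorem sum_conj_Fs_mul_Fs_HkOp_eq_zero (nn : ℕ) [NeZero nn] (M : Fin d → ℕ) [∀ μ, NeZero (M μ)]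
    (B : Tor M × Fin d → ℂ) (a : Tor (fine nn M) × Fin d → ℂ) (g : Tor M → ℂ)
    (ha : ∀ (t : Tor M) (κ : Fin d), (QvOp nn M *ᵥ a) (t, κ) = g (t + B5Prop11Plancherel.unitVec M κ) - g t) :
    ∑ t : Tor (fine nn M), ∑ μ : Fin d, ∑ ν : Fin d,
        conj (Fs (fine nn M) 1 a μ ν t) * Fs (fine nn M) 1 (HkOp nn M *ᵥ B) μ ν t = 0 := by
  have hnc : (nn : ℂ) ≠ 0 := by exact_mod_cast NeZero.ne nn
  -- the pure gauge with the same average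
  set lam : Tor (fine nn M) → ℂ := fun x => g (blockOf nn M x) with hlam
  set a₀ : Tor (fine nn M) × Fin d → ℂ := a - GradOp (fine nn M) (nn : ℂ) *ᵥ lam with ha₀
  have hQ : QvOp nn M *ᵥ a₀ = 0 := by
    have h1 : QvOp nn M *ᵥ (GradOp (fine nn M) (nn : ℂ) *ᵥ lam) = GradOp M 1 *ᵥ g := by
      rw [QvOp_GradOp_mulVec, hlam, QsOp_blockConst]
    funext p
    obtain ⟨t, κ⟩ := p
    rw [ha₀, Matrix.mulVec_sub, Pi.sub_apply, h1, ha, GradOp_mulVec, sdiff_mulVec, one_mul, Pi.zero_apply, sub_self]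
  -- lit-balaban's orthogonality for `a₀`
  have horth := curl_HkOp_orthogonal nn M B a₀ hQ
  -- expand the dot product
  have hexp : star (CurlOp (fine nn M) (nn : ℂ) *ᵥ a₀) ⬝ᵥ (CurlOp (fine nn M) (nn : ℂ) *ᵥ (HkOp nn M *ᵥ B))
      = ∑ t : Tor (fine nn M), ∑ μ : Fin d, ∑ ν : Fin d,
          conj (Fs (fine nn M) (nn : ℂ) a₀ μ ν t) * Fs (fine nn M) (nn : ℂ) (HkOp nn M *ᵥ B) μ ν t := by
    rw [dotProduct, Fintype.sum_prod_type]
    refine Finset.sum_congr rfl fun t _ => ?_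
    rw [Fintype.sum_prod_type]
    refine Finset.sum_congr rfl fun μ _ => Finset.sum_congr rfl fun ν _ => ?_
    rw [Pi.star_apply, CurlOp_mulVec, CurlOp_mulVec, RCLike.star_def]
  -- the pure gauge has no plaquette field, and `Fs c = c·Fs 1`
  have hFa : ∀ μ ν t, Fs (fine nn M) (nn : ℂ) a₀ μ ν t = (nn : ℂ) * Fs (fine nn M) 1 a μ ν t := by
    intro μ ν t
    have hsplit : a = a₀ + GradOp (fine nn M) (nn : ℂ) *ᵥ lam := by rw [ha₀]; abel
    have h1 : Fs (fine nn M) (nn : ℂ) a μ ν t = Fs (fine nn M) (nn : ℂ) a₀ μ ν t := by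
      conv_lhs => rw [hsplit]
      rw [Beta.Ineq167Operator.Fs_add, Beta.Ineq167Operator.Fs_grad, add_zero]
    rw [← h1, Fs_eq_mul_Fs_one]
  have hFh : ∀ μ ν t, Fs (fine nn M) (nn : ℂ) (HkOp nn M *ᵥ B) μ ν t = (nn : ℂ) * Fs (fine nn M) 1 (HkOp nn M *ᵥ B) μ ν t :=
    fun μ ν t => Fs_eq_mul_Fs_one _ _ _ μ ν t
  rw [hexp] at horth
  simp only [hFa, hFh, map_mul, Complex.conj_natCast] at horth
  -- `horth : Σ_t Σ_μ Σ_ν (nn·conj F1a)·(nn·F1h) = 0`; factor `nn²`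
  have hfac : ∑ t : Tor (fine nn M), ∑ μ : Fin d, ∑ ν : Fin d,
      (nn : ℂ) * conj (Fs (fine nn M) 1 a μ ν t) * ((nn : ℂ) * Fs (fine nn M) 1 (HkOp nn M *ᵥ B) μ ν t)
      = (nn : ℂ) ^ 2 * ∑ t : Tor (fine nn M), ∑ μ : Fin d, ∑ ν : Fin d,
          conj (Fs (fine nn M) 1 a μ ν t) * Fs (fine nn M) 1 (HkOp nn M *ᵥ B) μ ν t := by
    simp only [Finset.mul_sum]
    refine Finset.sum_congr rfl fun t _ => Finset.sum_congr rfl fun μ _ => Finset.sum_congr rfl fun ν _ => ?_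
    ring
  rw [hfac] at horth
  exact (mul_eq_zero.mp horth).resolve_left (pow_ne_zero 2 hnc)

/-! ## §4 The T4 tangent condition read on the torus: every entry has a coarse-exact average -/

omit [Fintype n] [DecidableEq n] in
/-- A `P`-periodic coarse potential reads through `rep ∘ toT`. [folklore] -/
theorem applyS_rep_toT {𝔸 : Type*} {P : ℕ} [NeZero P] {G : Site d → 𝔸} (hG : ∀ (z : Site d) (τ : Fin d), G (z + (P : ℤ) • e τ) = G z)
    (x : Site d) : G (rep (fun _ : Fin d => P) (toT (fun _ : Fin d => P) x)) = G x := by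
  have h := isPeriod_rep_toT_sub (fun _ : Fin d => P) x
  set v := rep (fun _ : Fin d => P) (toT (fun _ : Fin d => P) x) - x with hv
  have e1 : rep (fun _ : Fin d => P) (toT (fun _ : Fin d => P) x) = x + v := by rw [hv]; abel
  have hk : v = (P : ℤ) • fun i => v i / (P : ℤ) := by
    funext i
    obtain ⟨c, hc⟩ := h i
    simp only [Pi.smul_apply, smul_eq_mul]
    rw [hc]
    by_cases hP : (P : ℤ) = 0
    · rw [hP]; simp
    · rw [Int.mul_ediv_cancel_left _ hP]
  rw [e1, hk]
  exact AveragingDeficitTorusChart.periodic_smul_vec (f := G) hG x _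

/-- **A T4 TANGENT DIRECTION AT THE FLAT BACKGROUND HAS, ENTRY BY ENTRY, A COARSE-EXACT lit-balaban AVERAGE**: for `Y` skew or not,
`(n·P)`-periodic (`n = L^{j+1}`) with `cpushIter L j flat Y = 0`, every entry `y_{ii′}(p) = Y(rep p.1, p.2)_{ii′}` of its torus restriction
satisfies `Q_k y_{ii′}(t,κ) = g(t + u_κ) − g(t)` with `g(t) = n⁻¹·(framePot L (j+1) Y)(rep t)_{ii′}` (row NE3's frame potential, coarse
`P`-periodic by `framePot_add_period`; the straight average is `n·Q_k` on pull-backs, F35). [folklore] -/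
theorem qvOp_entry_coarse_exact {L : ℕ} (hL : 1 ≤ L) (j : ℕ) {P : ℕ} [NeZero P] [NeZero (L ^ (j + 1))]
    {Y : Site d → Fin d → Matrix n n ℂ} (hYP : IsPeriodicDir Y ((L ^ (j + 1) * P : ℕ) : ℤ))
    (hYT : cpushIter L j (flat (d := d) (n := n)) Y = 0) (i i' : n) (t : Tor (fun _ : Fin d => P)) (κ : Fin d) :
    (QvOp (L ^ (j + 1)) (fun _ : Fin d => P) *ᵥ
        fun p : Tor (fine (L ^ (j + 1)) (fun _ : Fin d => P)) × Fin d =>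
          Y (rep (fine (L ^ (j + 1)) (fun _ : Fin d => P)) p.1) p.2 i i') (t, κ)
      = ((L ^ (j + 1) : ℕ) : ℂ)⁻¹ * framePot L (j + 1) Y (rep (fun _ : Fin d => P) (t + B5Prop11Plancherel.unitVec (fun _ : Fin d => P) κ)) i i'
        - ((L ^ (j + 1) : ℕ) : ℂ)⁻¹ * framePot L (j + 1) Y (rep (fun _ : Fin d => P) t) i i' := by
  have hnc : ((L ^ (j + 1) : ℕ) : ℂ) ≠ 0 := by exact_mod_cast NeZero.ne (L ^ (j + 1))
  haveI hNP : NeZero (L ^ (j + 1) * P) := ⟨Nat.mul_ne_zero (NeZero.ne (L ^ (j + 1))) (NeZero.ne P)⟩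
  -- the T4 tangent condition: the straight `(j+1)`-fold average is the coboundary of the frame potential
  have hT : (SmoothRefineNeutral.Tcoarse L)^[j + 1] Y = 0 := by rw [← cpushIter_flat hL]; exact hYT
  have hQ := (iterate_Tcoarse_eq_zero_iff hL (j + 1) Y).mp hT
  have hz := congrFun (congrFun hQ (rep (fun _ : Fin d => P) t)) κ
  rw [iterate_Qcoarse_apply] at hz
  have hent := congrFun (congrFun hz i) i'
  rw [linQ_apply_entry] at hent
  -- the entry field is the pull-back of its torus restriction
  have hpull : (fun (x : Site d) (μ : Fin d) => Y x μ i i')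
      = fun (x : Site d) (μ : Fin d) => (fun p : Tor (fine (L ^ (j + 1)) (fun _ : Fin d => P)) × Fin d =>
          Y (rep (fine (L ^ (j + 1)) (fun _ : Fin d => P)) p.1) p.2 i i') (toT (fine (L ^ (j + 1)) (fun _ : Fin d => P)) x, μ) := by
    funext x μ
    exact (apply_rep_toT' (P := L ^ (j + 1) * P) hYP x μ ▸ rfl)
  have hlin := linQ_pullback_eq (L ^ (j + 1)) (fun _ : Fin d => P)
    (fun p : Tor (fine (L ^ (j + 1)) (fun _ : Fin d => P)) × Fin d => Y (rep (fine (L ^ (j + 1)) (fun _ : Fin d => P)) p.1) p.2 i i') t κ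
  rw [← hpull, hent] at hlin
  -- `hlin : dPot G (rep t) κ i i' = n * (QvOp y)(t,κ)`; the coboundary of the periodic frame potential read on the torus
  have hGP : ∀ (z : Site d) (τ : Fin d), framePot L (j + 1) Y (z + (P : ℤ) • e τ) = framePot L (j + 1) Y z :=
    framePot_add_period L (j + 1) Y (P := (P : ℤ)) (fun y τ μ => by
      have := hYP y τ μ; push_cast at this; exact this)
  have hG1 : framePot L (j + 1) Y (rep (fun _ : Fin d => P) t + e κ)
      = framePot L (j + 1) Y (rep (fun _ : Fin d => P) (t + B5Prop11Plancherel.unitVec (fun _ : Fin d => P) κ)) := by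
    rw [← applyS_rep_toT (P := P) hGP (rep (fun _ : Fin d => P) t + e κ), toT_add_e', toT_rep]
  have hd : dPot (framePot L (j + 1) Y) (rep (fun _ : Fin d => P) t) κ i i'
      = framePot L (j + 1) Y (rep (fun _ : Fin d => P) (t + B5Prop11Plancherel.unitVec (fun _ : Fin d => P) κ)) i i'
        - framePot L (j + 1) Y (rep (fun _ : Fin d => P) t) i i' := by
    simp only [dPot, hG1, Matrix.sub_apply]
  rw [hd] at hlin
  -- divide by `n`
  rw [← mul_sub, hlin, ← mul_assoc, inv_mul_cancel₀ hnc, one_mul]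

/-! ## §5 THE END: the (R⊥♭) letter — the flat Landau lift is Hessian-orthogonal to the tangent space -/

omit [Fintype n] [DecidableEq n] in
/-- Entries of a skew-Hermitian matrix: `A_{ii′} = −conj A_{i′i}`. [folklore] -/
theorem entry_eq_neg_conj_of_skew {A : Matrix n n ℂ} (hA : A ∈ skewAdjoint (Matrix n n ℂ)) (i i' : n) :
    A i i' = -conj (A i' i) := by
  rw [skewAdjoint.mem_iff] at hA
  have h := congrFun (congrFun hA i) i'
  rw [Matrix.star_apply, Matrix.neg_apply, RCLike.star_def] at h
  rw [h, neg_neg]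

/-- **(R⊥♭) — lit-balaban's LANDAU LIFT `H_k`, PULLED BACK ENTRYWISE AND CORRECTED (bricks 2–3), IS `hess`-ORTHOGONAL AT THE FLAT BACKGROUND TO
EVERY SKEW PERIODIC TANGENT DIRECTION**: for `B : Tor (P,…,P) × Fin d → Matrix`, `n = L^{j+1}`, `A_H(x,κ)_{ii′} = (H_k B_{ii′})(toT x, κ)` and the
right inverse `R_H B = A_H + dPot (interp n univ (framePot L (j+1) A_H))` of F36, and every skew `(n·P)`-periodic `Y` with `cpushIter L j flat Y = 0`:
`hess flat (R_H B) Y (perWin d (n·P)) = 0`.  PROOF: `hess` at a flat background is the curl pairing (F38 `hess_flat`); the corrector is curl-free;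
entrywise the flat curls are lit-balaban's plaquette fields of the torus restrictions (§2); skewness turns `Re tr` into `−Re Σ_e conj(F(y_e))·F(h_e)`;
box ↔ torus and planes ↔ ordered pairs (§1); every entry of `Y` has a coarse-exact average (§4), so §3 (lit-balaban's minimum property) kills each
entry pairing.  This is the (R⊥) letter of F38's bundle AT THE TRIVIAL FLAT DATUM (the commuting-holonomy twist stays open).
[cite: Balaban1984PropagatorsI, p.29 (text) «H_kB is a minimum of ½⟨∂A,∂A⟩ on the hyperplane {A : Q_kA = B, R∂*A = 0}»] -/
theorem hess_flat_hkLift_eq_zero {L : ℕ} (hL : 1 ≤ L) (j : ℕ) {P : ℕ} [NeZero P] [NeZero (L ^ (j + 1))]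
    (B : Tor (fun _ : Fin d => P) × Fin d → Matrix n n ℂ)
    {Y : Site d → Fin d → Matrix n n ℂ} (hYs : IsSkewDir Y) (hYP : IsPeriodicDir Y ((L ^ (j + 1) * P : ℕ) : ℤ))
    (hYT : cpushIter L j (flat (d := d) (n := n)) Y = 0) :
    hess (flat (d := d) (n := n))
        ((fun (x : Site d) (κ : Fin d) => Matrix.of fun i i' : n =>
            (HkOp (L ^ (j + 1)) (fun _ : Fin d => P) *ᵥ fun p : Tor (fun _ : Fin d => P) × Fin d => B p i i')
              (toT (fine (L ^ (j + 1)) (fun _ : Fin d => P)) x, κ))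
          + dPot (interp (L ^ (j + 1)) Finset.univ (framePot L (j + 1)
              (fun (x : Site d) (κ : Fin d) => Matrix.of fun i i' : n =>
                (HkOp (L ^ (j + 1)) (fun _ : Fin d => P) *ᵥ fun p : Tor (fun _ : Fin d => P) × Fin d => B p i i')
                  (toT (fine (L ^ (j + 1)) (fun _ : Fin d => P)) x, κ)))))
        Y (perWin d (L ^ (j + 1) * P)) = 0 := by
  haveI hNP : NeZero (L ^ (j + 1) * P) := ⟨Nat.mul_ne_zero (NeZero.ne (L ^ (j + 1))) (NeZero.ne P)⟩
  -- abbreviations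
  set F : Fin d → ℕ := fine (L ^ (j + 1)) (fun _ : Fin d => P) with hF
  set h : n → n → (Tor F × Fin d → ℂ) :=
    fun i i' => HkOp (L ^ (j + 1)) (fun _ : Fin d => P) *ᵥ fun p : Tor (fun _ : Fin d => P) × Fin d => B p i i' with hh
  set AH : Site d → Fin d → Matrix n n ℂ := fun x κ => Matrix.of fun i i' : n => h i i' (toT F x, κ) with hAH
  set y : n → n → (Tor F × Fin d → ℂ) := fun i i' p => Y (rep F p.1) p.2 i i' with hy
  set G := interp (L ^ (j + 1)) Finset.univ (framePot L (j + 1) AH) with hG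
  -- the pairing
  have hflat0 : SmallField (flat (d := d) (n := n)) 0 := by rw [← flatCfg_eq_flat]; exact smallField_flatCfg_zero
  rw [hess_flat hflat0, neg_eq_zero]
  -- entrywise flat curls
  have hXe : ∀ (z : Site d) (μ ν : Fin d) (i i' : n), curlAt (flat (d := d) (n := n)) (AH + dPot G) z μ ν i i' = Fs F 1 (h i i') μ ν (toT F z) := by
    intro z μ ν i i'
    rw [curlAt_flat_add, curlAt_flat_dPot, add_zero, hAH, curlAt_flat_eq, Fs_apply, one_mul, toT_add_e', toT_add_e']
    simp only [Matrix.sub_apply, Matrix.of_apply]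
    ring
  have hYe : ∀ (z : Site d) (μ ν : Fin d) (i i' : n), curlAt (flat (d := d) (n := n)) Y z μ ν i i' = Fs F 1 (y i i') μ ν (toT F z) :=
    fun z μ ν i i' => curlAt_flat_entry_torus (P := L ^ (j + 1) * P) hYP z μ ν i i'
  -- skewness on the torus side
  have hskew : ∀ (μ ν : Fin d) (tt : Tor F) (i i' : n), Fs F 1 (y i i') μ ν tt = -conj (Fs F 1 (y i' i) μ ν tt) := by
    intro μ ν tt i i'
    simp only [Fs_apply, one_mul, hy, entry_eq_neg_conj_of_skew (hYs _ _) i i', map_add, map_sub]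
    ring
  -- the entry pairing of one plaquette
  set c : n × n → T4AveragingDeficitWall.Plaq d → ℂ :=
    fun e p => conj (Fs F 1 (y e.1 e.2) p.2.1.1 p.2.1.2 (toT F p.1)) * Fs F 1 (h e.1 e.2) p.2.1.1 p.2.1.2 (toT F p.1) with hc
  have hterm : ∀ p : T4AveragingDeficitWall.Plaq d,
      UnitaryModel.nReTr (curl (flat (d := d) (n := n)) Y p * curl (flat (d := d) (n := n)) (AH + dPot G) p)
        = -((∑ e : n × n, c e p).re / Fintype.card n) := by
    intro p
    unfold UnitaryModel.nReTr
    rw [Matrix.trace]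
    simp only [Matrix.diag, Matrix.mul_apply]
    have hsum : ∑ i : n, ∑ i' : n, curl (flat (d := d) (n := n)) Y p i i' * curl (flat (d := d) (n := n)) (AH + dPot G) p i' i
        = -∑ e : n × n, c e p := by
      show ∑ i : n, ∑ i' : n, curlAt (flat (d := d) (n := n)) Y p.1 p.2.1.1 p.2.1.2 i i'
          * curlAt (flat (d := d) (n := n)) (AH + dPot G) p.1 p.2.1.1 p.2.1.2 i' i = -∑ e : n × n, c e p
      rw [Finset.sum_comm, Fintype.sum_prod_type, ← Finset.sum_neg_distrib]
      refine Finset.sum_congr rfl fun i' _ => ?_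
      rw [← Finset.sum_neg_distrib]
      refine Finset.sum_congr rfl fun i _ => ?_
      rw [hYe, hXe, hskew, hc]
      ring
    rw [hsum, Complex.neg_re, neg_div]
  -- every entry pairing vanishes over the period window
  have hinner : ∀ e : n × n, ∑ p ∈ perWin d (L ^ (j + 1) * P), c e p = 0 := by
    intro e
    unfold perWin
    rw [Finset.sum_product]
    have hbox := sum_periodBox_toT (d := d) (L ^ (j + 1) * P)
      (fun tt => ∑ π : T4AveragingDeficitWall.Plane d, conj (Fs F 1 (y e.1 e.2) π.1.1 π.1.2 tt) * Fs F 1 (h e.1 e.2) π.1.1 π.1.2 tt)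
    simp only [hc]
    rw [hbox]
    -- planes ↔ ordered pairs, per torus point
    have hpl : ∀ tt : Tor F, ∑ π : T4AveragingDeficitWall.Plane d, conj (Fs F 1 (y e.1 e.2) π.1.1 π.1.2 tt) * Fs F 1 (h e.1 e.2) π.1.1 π.1.2 tt
        = 1 / 2 * ∑ μ : Fin d, ∑ ν : Fin d, conj (Fs F 1 (y e.1 e.2) μ ν tt) * Fs F 1 (h e.1 e.2) μ ν tt := by
      intro tt
      rw [sum_sum_eq_two_mul_sum_plane_complex (fun μ ν => conj (Fs F 1 (y e.1 e.2) μ ν tt) * Fs F 1 (h e.1 e.2) μ ν tt)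
        (fun μ => by simp [Fs_apply]) (fun μ ν => by
          have a1 : Fs F 1 (y e.1 e.2) ν μ tt = -Fs F 1 (y e.1 e.2) μ ν tt := by rw [Fs_apply, Fs_apply]; ring
          have a2 : Fs F 1 (h e.1 e.2) ν μ tt = -Fs F 1 (h e.1 e.2) μ ν tt := by rw [Fs_apply, Fs_apply]; ring
          simp only [a1, a2, map_neg, neg_mul_neg])]
      ring
    simp only [hpl]
    rw [← Finset.mul_sum,
      sum_conj_Fs_mul_Fs_HkOp_eq_zero (L ^ (j + 1)) (fun _ : Fin d => P) (fun p => B p e.1 e.2) (y e.1 e.2)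
        (fun tt => ((L ^ (j + 1) : ℕ) : ℂ)⁻¹ * framePot L (j + 1) Y (rep (fun _ : Fin d => P) tt) e.1 e.2)
        (fun tt κ => qvOp_entry_coarse_exact hL j hYP hYT e.1 e.2 tt κ),
      mul_zero]
  -- assemble
  calc ∑ p ∈ perWin d (L ^ (j + 1) * P), UnitaryModel.nReTr (curl (flat (d := d) (n := n)) Y p * curl (flat (d := d) (n := n)) (AH + dPot G) p)
      = ∑ p ∈ perWin d (L ^ (j + 1) * P), -((∑ e : n × n, c e p).re / Fintype.card n) := Finset.sum_congr rfl fun p _ => hterm p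
    _ = -((∑ p ∈ perWin d (L ^ (j + 1) * P), ∑ e : n × n, c e p).re / Fintype.card n) := by
        rw [Finset.sum_neg_distrib, Complex.re_sum, Finset.sum_div]
    _ = 0 := by
        rw [Finset.sum_comm]
        simp only [hinner, Finset.sum_const_zero, Complex.zero_re, zero_div, neg_zero]

end

end Summit.QuantumFields.BalabanUV.T4Continuum.NE7FlatHkOrthogonal
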